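import Summits.CriticalPhenomena.Ising3DConformalLimit.Theorems.IsingEuclidUpgradeR4NonGaussianMomentRatioBubble
import HarnessLib

/-!
# Crux `GaussianLimitNotScreened` (stmt-CriticalPhenomena-13886), line `karamata-amplitude-blind-merging`:
# the Karamata dyadic shell sums (registered stub `stub_dyadicShellSums`)

THEOREM-ONLY helper file (no definitions). For a pointwise scaling limit `S` of the critical Ising₃
correlators with non-degenerate two-point function, the covariance relation
`S₂(0,2e₀) = 2^{-2Δ}S₂(0,e₀)`, and an exponent `0 ≤ s < 3 - 2Δ`:

  `∃ K > 0, ∃ i₀, ∀ J ≥ i₀, ∑_{0 < ‖u‖_∞ ≤ 2^{J+2}} ‖u‖^{-s} ⟨σ₀σ_u⟩_{β_c} ≤ K · 8^J · 2^{-sJ} · ⟨σ₀σ_{2^J e₀}⟩_{β_c}`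

(`stub_dyadicShellSums`): Karamata's theorem for the lattice sums `∑ ‖u‖^{-s} G(u)` in dyadic form —
the sum at scale `2^J` is carried by its top dyadic shell. Mechanism (verbatim the landed bubble
bound `stub_momentRatioBubble`, with `G²` replaced by `‖u‖^{-s} G`): each dyadic shell
`2^{j+2} < ‖u‖_∞ ≤ 2^{j+3}` has `≤ 2^15 8^j` sites, on it `‖u‖^{-s} ≤ 2^{-sj}` and
`G(u) ≤ G(2^j e₀)` (Messager–Miracle-Solé, tree theorem `twoPointPlus_le_of_mul_supNorm_le`), while
`G(2^j e₀)/G(2^{j+1} e₀) → 2^{2Δ} < 2^{3-s} = 8 · 2^{-s}` along the dyadic meshes (tree theorem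
`tendsto_rescaled_dyadic` at `(0,e₀)` and `(0,2e₀)`), so `8^j 2^{-sj} G(2^j e₀)` grows geometrically —
the only place where `s < 3 - 2Δ` enters (regular variation of index `-2Δ` along the axis, Karamata
index `3 - s - 2Δ > 0`; Bingham–Goldie–Teugels §1.5).

References: N. H. Bingham, C. M. Goldie, J. L. Teugels, Regular Variation, CUP (1987), §1.5.6
(Karamata's theorem); M. Aizenman, H. Duminil-Copin, Ann. Math. 194 (2021), §4.2;
A. Messager, S. Miracle-Solé, J. Stat. Phys. 17 (1977).
-/

noncomputable section

open Filter Topology Set Function MeasureTheory Finset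
open Literature.Probability.LatticeModels Literature.Probability.Percolation

namespace Summit.CriticalPhenomena.Ising3DConformalLimit.Cruxes.GaussianLimitNotScreened.KaramataAmplitudeBlindMerging

-- adapted from Theorems/IsingEuclidUpgradeR4NonGaussianMomentRatioBubble.lean (private lemmas)

/-- `0 < ⟨σ₀σ_u⟩_{β_c}` on `ℤ³` (Simon–Lieb lower bound off the origin, `= 1` at the origin). [folklore] -/
private theorem criticalTwoPoint_pos (u : Site 3) : 0 < criticalTwoPoint 3 u := by
  by_cases hu : u = 0
  · rw [hu, criticalTwoPoint_zero']; exact one_pos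
  · obtain ⟨c, C, hc, h⟩ := criticalTwoPoint_bounds_holds (d := 3) le_rfl
    have hn : 0 < ‖u‖ := norm_pos_iff.2 hu
    exact lt_of_lt_of_le (mul_pos hc (Real.rpow_pos_of_pos hn _)) (h u hu).1

/-- `‖m e₀‖_∞ = m`. [folklore] -/
private theorem supNorm_single_nat (m : ℕ) :
    Site.supNorm (Pi.single (0 : Fin 3) (m : ℤ) : Site 3) = m := by
  apply le_antisymm
  · rw [Site.supNorm_le_iff]
    intro j
    by_cases hj : j = 0
    · subst hj; simp
    · rw [Pi.single_eq_of_ne hj]; simp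
  · have := Site.natAbs_le_supNorm (Pi.single (0 : Fin 3) (m : ℤ) : Site 3) 0
    simpa using this

/-- Messager–Miracle-Solé: `⟨σ₀σ_u⟩ ≤ ⟨σ₀σ_{m e₀}⟩` whenever `3m ≤ ‖u‖_∞`.
[cite: MessagerMiracleSoleJSP1977, Theorem (monotonicity)] -/
private theorem criticalTwoPoint_le_axis {u : Site 3} {m : ℕ} (h : 3 * m ≤ Site.supNorm u) :
    criticalTwoPoint 3 u ≤ criticalTwoPoint 3 (Pi.single (0 : Fin 3) (m : ℤ)) :=
  twoPointPlus_le_of_mul_supNorm_le (d := 3) (criticalBeta_nonneg 3)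
    (x := Pi.single (0 : Fin 3) (m : ℤ)) (y := u) (by rwa [supNorm_single_nat])

/-- **Dyadic ratio bound, first power**: for `s < 3 - 2Δ` there is `θ < 8 · 2^{-s} = 2^{3-s}` with
`⟨σ₀σ_{2^i e₀}⟩ ≤ θ ⟨σ₀σ_{2^{i+1}e₀}⟩` for all large `i`
(`⟨σ₀σ_{2^i e₀}⟩/⟨σ₀σ_{2^{i+1}e₀}⟩ → 2^{2Δ}` from the limit at `(0,e₀)`, `(0,2e₀)`). [folklore] -/
private theorem eventually_dyadic_le {ρ : ℝ → ℝ} {S : CorrFamily 3} {Δ s : ℝ}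
    (hlim : HasPointwiseScalingLimit (criticalCorr 3) ρ S) (hnd : IsNondegenerateTwoPoint S)
    (hs₂eq : S 2 ![0, EuclideanSpace.single (0 : Fin 3) ((2 : ℕ) : ℝ)] =
      (2 : ℝ) ^ (-(2 : ℝ) * Δ) * S 2 ![0, EuclideanSpace.single (0 : Fin 3) ((1 : ℕ) : ℝ)])
    (hs : s < 3 - 2 * Δ) :
    ∃ θ : ℝ, 0 < θ ∧ θ < 8 * (2 : ℝ) ^ (-s) ∧ ∀ᶠ i : ℕ in atTop,
      criticalTwoPoint 3 (Pi.single (0 : Fin 3) ((2:ℤ) ^ i)) ≤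
        θ * criticalTwoPoint 3 (Pi.single (0 : Fin 3) ((2:ℤ) ^ (i + 1))) := by
  set s₁ := S 2 ![0, EuclideanSpace.single (0 : Fin 3) ((1 : ℕ) : ℝ)] with hs₁
  set s₂ := S 2 ![0, EuclideanSpace.single (0 : Fin 3) ((2 : ℕ) : ℝ)] with hs₂
  have hs₁pos : 0 < s₁ := hnd _ (zero_unitVec_mem_nonCoincident (by norm_num))
  have hs₂pos : 0 < s₂ := hnd _ (zero_unitVec_mem_nonCoincident (by norm_num))
  -- θ₀ = s₁/s₂ = 2^{2Δ} < 2^{3-s} = 8 · 2^{-s}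
  set θ₀ : ℝ := s₁ / s₂ with hθ₀def
  have hθ₀ : θ₀ = (2:ℝ) ^ (2 * Δ) := by
    rw [hθ₀def, eq_comm, eq_div_iff hs₂pos.ne', hs₂eq, ← mul_assoc, ← Real.rpow_add two_pos]
    have : 2 * Δ + -(2:ℝ) * Δ = 0 := by ring
    rw [this, Real.rpow_zero, one_mul]
  have hM : 8 * (2:ℝ) ^ (-s) = (2:ℝ) ^ (3 - s) := by
    rw [show (3:ℝ) - s = 3 + -s by ring, Real.rpow_add two_pos]
    norm_num
  have hθ₀M : θ₀ < 8 * (2:ℝ) ^ (-s) := by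
    rw [hθ₀, hM]
    exact Real.rpow_lt_rpow_of_exponent_lt one_lt_two (by linarith)
  have hθ₀pos : 0 < θ₀ := by rw [hθ₀]; positivity
  set θ : ℝ := (θ₀ + 8 * (2:ℝ) ^ (-s)) / 2 with hθdef
  have hθθ : θ₀ < θ := by rw [hθdef]; linarith
  refine ⟨θ, by rw [hθdef]; linarith, by rw [hθdef]; linarith, ?_⟩
  -- the two dyadic sequences
  have h1 := tendsto_rescaled_dyadic hlim (t := 1) one_ne_zero
  have h2 := tendsto_rescaled_dyadic hlim (t := 2) two_ne_zero
  have hdiv := h1.div h2 hs₂pos.ne'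
  have hev := hdiv.eventually_lt_const hθθ
  have hpos := h2.eventually_const_lt hs₂pos
  obtain ⟨N, hN⟩ := eventually_atTop.1 (hev.and hpos)
  refine eventually_atTop.2 ⟨N + 1, fun i hi => ?_⟩
  obtain ⟨k, rfl⟩ : ∃ k, i = k + 1 := ⟨i - 1, by omega⟩
  obtain ⟨hk1, hk2⟩ := hN k (by omega)
  have e1 : (((1:ℕ):ℤ) * 2 ^ (k + 1)) = (2:ℤ) ^ (k + 1) := by push_cast; ring
  have e2 : (((2:ℕ):ℤ) * 2 ^ (k + 1)) = (2:ℤ) ^ (k + 1 + 1) := by push_cast; ring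
  simp only [e1, e2, Pi.div_apply] at hk1 hk2
  set r := ρ ((2:ℝ)⁻¹ ^ (k + 1)) ^ 2 with hr
  set g₁ := criticalTwoPoint 3 (Pi.single (0 : Fin 3) ((2:ℤ) ^ (k + 1))) with hg₁
  set g₂ := criticalTwoPoint 3 (Pi.single (0 : Fin 3) ((2:ℤ) ^ (k + 1 + 1))) with hg₂
  have hrpos : 0 < r := by
    rcases (sq_nonneg (ρ ((2:ℝ)⁻¹ ^ (k + 1)))).lt_or_eq with h | h
    · exact h
    · exfalso; rw [hr, ← h, zero_mul] at hk2; exact lt_irrefl _ hk2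
  rw [div_lt_iff₀ hk2] at hk1
  have h' : r * g₁ < r * (θ * g₂) := by
    calc r * g₁ < θ * (r * g₂) := hk1
      _ = r * (θ * g₂) := by ring
  exact (lt_of_mul_lt_mul_left h' hrpos.le).le

/-- **Registered stub `stub_dyadicShellSums` — Karamata's theorem for the lattice sums
`∑ ‖u‖^{-s}⟨σ₀σ_u⟩`, dyadic form**: for `0 ≤ s < 3 - 2Δ` there are `K > 0` and `i₀` with
`∑_{0<‖u‖_∞≤2^{J+2}} ‖u‖^{-s}⟨σ₀σ_u⟩_{β_c} ≤ K · 8^J · 2^{-sJ} · ⟨σ₀σ_{2^J e₀}⟩_{β_c}` for all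
`J ≥ i₀` — the sum at scale `2^J` is carried by its top dyadic shell (geometric growth of
`8^j 2^{-sj}⟨σ₀σ_{2^j e₀}⟩`, ratio `→ 2^{3-s-2Δ} > 1` exactly when `s < 3 - 2Δ`; MMS bounds each shell
by the axis value). [cite: BinghamGoldieTeugels1987, §1.5.6, Karamata's theorem (direct half)] -/
theorem stub_dyadicShellSums :
    ∀ (ρ : ℝ → ℝ) (S : CorrFamily 3) (Δ : ℝ), HasPointwiseScalingLimit (criticalCorr 3) ρ S →
      IsNondegenerateTwoPoint S →
      S 2 ![0, EuclideanSpace.single (0 : Fin 3) ((2 : ℕ) : ℝ)] =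
        (2 : ℝ) ^ (-(2 : ℝ) * Δ) * S 2 ![0, EuclideanSpace.single (0 : Fin 3) ((1 : ℕ) : ℝ)] →
      ∀ s : ℝ, 0 ≤ s → s < 3 - 2 * Δ →
      ∃ K : ℝ, 0 < K ∧ ∃ i₀ : ℕ, ∀ J : ℕ, i₀ ≤ J →
        ∑ u ∈ (box 3 (2 ^ (J + 2))).erase 0, (‖u‖ : ℝ) ^ (-s) * criticalTwoPoint 3 u ≤
          K * (8 : ℝ) ^ J * (2 : ℝ) ^ (-(s * J)) * criticalTwoPoint 3 (Pi.single (0 : Fin 3) ((2 : ℤ) ^ J)) := by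
  intro ρ S Δ hlim hnd hs₂eq s hs0 hs
  obtain ⟨θ, hθ, hθM, hev⟩ := eventually_dyadic_le hlim hnd hs₂eq hs
  obtain ⟨i₀, hi₀⟩ := eventually_atTop.1 hev
  -- opaque names: `M = 8·2^{-s}`, `g J = G(2^J e₀)`, `w J = 2^{-sJ}`, `Φ J` the shell sum
  obtain ⟨M, hM⟩ : ∃ M : ℝ, M = 8 * (2:ℝ) ^ (-s) := ⟨_, rfl⟩
  rw [← hM] at hθM
  obtain ⟨g, hg⟩ : ∃ g : ℕ → ℝ, ∀ J, g J = criticalTwoPoint 3 (Pi.single (0 : Fin 3) ((2:ℤ) ^ J)) :=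
    ⟨_, fun _ => rfl⟩
  obtain ⟨w, hw⟩ : ∃ w : ℕ → ℝ, ∀ J : ℕ, w J = (2:ℝ) ^ (-(s * J)) := ⟨_, fun _ => rfl⟩
  obtain ⟨Φ, hΦ⟩ : ∃ Φ : ℕ → ℝ, ∀ J,
      Φ J = ∑ u ∈ (box 3 (2 ^ (J + 2))).erase 0, (‖u‖ : ℝ) ^ (-s) * criticalTwoPoint 3 u :=
    ⟨_, fun _ => rfl⟩
  have hgpos : ∀ J, 0 < g J := fun J => by rw [hg]; exact criticalTwoPoint_pos _
  have hwpos : ∀ J, 0 < w J := fun J => by rw [hw]; exact Real.rpow_pos_of_pos two_pos _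
  have hgθ : ∀ J, i₀ ≤ J → g J ≤ θ * g (J + 1) := fun J hJ => by
    rw [hg J, hg (J + 1)]; exact hi₀ J hJ
  -- `w (J+1) = w J · 2^{-s}` and `w J = (2^J)^{-s}`
  have hwsucc : ∀ J : ℕ, w (J + 1) = w J * (2:ℝ) ^ (-s) := by
    intro J
    rw [hw, hw, ← Real.rpow_add two_pos]
    congr 1
    push_cast
    ring
  have hwpow : ∀ J : ℕ, w J = ((2:ℝ) ^ J) ^ (-s) := by
    intro J
    rw [hw J, ← Real.rpow_natCast 2 J, ← Real.rpow_mul zero_le_two]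
    congr 1
    ring
  -- one-step recurrence: the shell `2^{J+2} < ‖u‖_∞ ≤ 2^{J+3}` contributes `≤ 2^15 8^J · 2^{-sJ} g_J`
  have hstep : ∀ J, Φ (J + 1) ≤ Φ J + 2 ^ 15 * 8 ^ J * (w J * g J) := by
    intro J
    have hsub : (box 3 (2 ^ (J + 2))).erase 0 ⊆ (box 3 (2 ^ (J + 1 + 2))).erase 0 :=
      Finset.erase_subset_erase 0 (box_mono 3 (Nat.pow_le_pow_right (by norm_num) (by omega)))
    have hsplit := Finset.sum_sdiff hsub (f := fun u => (‖u‖ : ℝ) ^ (-s) * criticalTwoPoint 3 u)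
    rw [hΦ (J + 1), hΦ J, ← hsplit, add_comm]
    refine add_le_add le_rfl ?_
    -- each term of the shell is `≤ w J * g J`, and there are `≤ 2^15 8^J` of them
    have hterm : ∀ u ∈ (box 3 (2 ^ (J + 1 + 2))).erase 0 \ (box 3 (2 ^ (J + 2))).erase 0,
        (‖u‖ : ℝ) ^ (-s) * criticalTwoPoint 3 u ≤ w J * g J := by
      intro u hu
      rw [Finset.mem_sdiff, Finset.mem_erase, Finset.mem_erase, mem_box_iff_supNorm_le] at hu
      obtain ⟨⟨hu0, hu1⟩, hu2⟩ := hu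
      have hu2' : ¬ Site.supNorm u ≤ 2 ^ (J + 2) := fun h => hu2 ⟨hu0, mem_box_iff_supNorm_le.2 h⟩
      have h3 : 3 * 2 ^ J ≤ Site.supNorm u := by
        have : 2 ^ (J + 2) = 4 * 2 ^ J := by ring
        omega
      have hle := criticalTwoPoint_le_axis (u := u) (m := 2 ^ J) h3
      push_cast at hle
      rw [← hg J] at hle
      have hnorm : (2:ℝ) ^ J ≤ ‖u‖ := by
        rw [Site.norm_eq_supNorm]
        exact_mod_cast (show 2 ^ J ≤ Site.supNorm u by omega)
      have hwle : (‖u‖ : ℝ) ^ (-s) ≤ w J := by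
        rw [hwpow J]
        exact Real.rpow_le_rpow_of_nonpos (by positivity) hnorm (by linarith)
      exact mul_le_mul hwle hle (criticalTwoPoint_nonneg' u) (hwpos J).le
    have hcard : (#((box 3 (2 ^ (J + 1 + 2))).erase 0 \ (box 3 (2 ^ (J + 2))).erase 0) : ℝ) ≤
        2 ^ 15 * 8 ^ J := by
      have h1 : #((box 3 (2 ^ (J + 1 + 2))).erase 0 \ (box 3 (2 ^ (J + 2))).erase 0) ≤
          #(box 3 (2 ^ (J + 1 + 2))) :=
        Finset.card_le_card (Finset.sdiff_subset.trans (Finset.erase_subset _ _))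
      rw [card_box] at h1
      have h2 : (2 * 2 ^ (J + 1 + 2) + 1) ^ 3 ≤ 2 ^ 15 * 8 ^ J := by
        have : 2 * 2 ^ (J + 1 + 2) + 1 ≤ 2 ^ (J + 5) := by
          have : 2 ^ (J + 5) = 2 * 2 ^ (J + 1 + 2) + 2 * 2 ^ (J + 1 + 2) := by ring
          have : 1 ≤ 2 ^ (J + 1 + 2) := Nat.one_le_two_pow
          omega
        calc (2 * 2 ^ (J + 1 + 2) + 1) ^ 3 ≤ (2 ^ (J + 5)) ^ 3 := Nat.pow_le_pow_left this 3
          _ = 2 ^ 15 * 8 ^ J := by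
            rw [← pow_mul, show (8:ℕ) = 2 ^ 3 by norm_num, ← pow_mul, ← pow_add]; ring_nf
      exact_mod_cast h1.trans h2
    calc ∑ u ∈ (box 3 (2 ^ (J + 1 + 2))).erase 0 \ (box 3 (2 ^ (J + 2))).erase 0,
          (‖u‖ : ℝ) ^ (-s) * criticalTwoPoint 3 u
        ≤ ∑ _u ∈ (box 3 (2 ^ (J + 1 + 2))).erase 0 \ (box 3 (2 ^ (J + 2))).erase 0, w J * g J :=
          Finset.sum_le_sum hterm
      _ = (#((box 3 (2 ^ (J + 1 + 2))).erase 0 \ (box 3 (2 ^ (J + 2))).erase 0) : ℝ) *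
            (w J * g J) := by
          rw [Finset.sum_const, nsmul_eq_mul]
      _ ≤ 2 ^ 15 * 8 ^ J * (w J * g J) :=
          mul_le_mul_of_nonneg_right hcard (mul_pos (hwpos J) (hgpos J)).le
  -- the constant
  have hMpos : 0 < M := by rw [hM]; positivity
  set K : ℝ := max (Φ i₀ / (8 ^ i₀ * (w i₀ * g i₀))) (2 ^ 15 * θ / (M - θ)) with hKdef
  have hK2 : 2 ^ 15 * θ / (M - θ) ≤ K := le_max_right _ _
  have hK1 : Φ i₀ / (8 ^ i₀ * (w i₀ * g i₀)) ≤ K := le_max_left _ _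
  have hKpos : 0 < K := lt_of_lt_of_le (div_pos (mul_pos (by norm_num) hθ) (by linarith)) hK2
  have hmain : ∀ J, i₀ ≤ J → Φ J ≤ K * 8 ^ J * (w J * g J) := by
    intro J hJ
    induction J, hJ using Nat.le_induction with
    | base =>
      have hden : 0 < (8:ℝ) ^ i₀ * (w i₀ * g i₀) :=
        mul_pos (by positivity) (mul_pos (hwpos i₀) (hgpos i₀))
      have := (div_le_iff₀ hden).1 hK1
      simpa only [mul_assoc] using this
    | succ J hJ ih =>
      have hθJ := hgθ J hJ
      have hKθ : (K + 2 ^ 15) * θ ≤ M * K := by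
        have h8 : 0 < M - θ := by linarith
        have := (div_le_iff₀ h8).1 hK2
        nlinarith
      have h8J : (0:ℝ) < 8 ^ J := by positivity
      have hK15 : (0:ℝ) ≤ K + 2 ^ 15 := add_nonneg hKpos.le (by positivity)
      calc Φ (J + 1) ≤ Φ J + 2 ^ 15 * 8 ^ J * (w J * g J) := hstep J
        _ ≤ K * 8 ^ J * (w J * g J) + 2 ^ 15 * 8 ^ J * (w J * g J) := by linarith [ih]
        _ = (K + 2 ^ 15) * 8 ^ J * (w J * g J) := by ring
        _ ≤ (K + 2 ^ 15) * 8 ^ J * (w J * (θ * g (J + 1))) := by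
            refine mul_le_mul_of_nonneg_left ?_ (mul_nonneg hK15 h8J.le)
            exact mul_le_mul_of_nonneg_left hθJ (hwpos J).le
        _ = ((K + 2 ^ 15) * θ) * 8 ^ J * (w J * g (J + 1)) := by ring
        _ ≤ (M * K) * 8 ^ J * (w J * g (J + 1)) := by
            refine mul_le_mul_of_nonneg_right (mul_le_mul_of_nonneg_right hKθ h8J.le) ?_
            exact (mul_pos (hwpos J) (hgpos (J + 1))).le
        _ = K * 8 ^ (J + 1) * (w (J + 1) * g (J + 1)) := by rw [hwsucc J, hM]; ring
  refine ⟨K, hKpos, i₀, fun J hJ => ?_⟩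
  have h := hmain J hJ
  rw [hΦ J, hw J, hg J] at h
  simpa only [mul_assoc] using h

end Summit.CriticalPhenomena.Ising3DConformalLimit.Cruxes.GaussianLimitNotScreened.KaramataAmplitudeBlindMerging

end
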